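import Summits.CriticalPhenomena.PercolationContinuityZ3.Theorems.PercNearOneGluingNoHeavyQuantBlobWalkHead
import Summits.CriticalPhenomena.PercolationContinuityZ3.Theorems.PercNearOneGluingNoHeavyQuantBlobWalkModel
import Summits.CriticalPhenomena.PercolationContinuityZ3.Theorems.PercNearOneGluingNoHeavyQuantIndepBlobGapRow
import HarnessLib

/-!
# QUANT lane R8 tool: the FAR exchange inequality for block-combs with ROOM AT THE BOTTOM
# (a group of blobs with gates `≥ 1/2`, tied to the bottom of the chain, carrying `≥ 2j + 2 − c` relays) — no budget hypothesis

builds on p205010 (kernel theorem, internal audit signed; external expert review pending)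

Support file (`--supports stmt-CriticalPhenomena-4575`), QUANT lane typer seat prim-quant-stmt (gen 14), rung R8 of
`run/shared/lean/prim/quant/LADDER.md`; typer target of the gen-11 lead (`prim-quant-lead-g11/LEAD-NOTES-G11.md` N22 (3′)/(3″) (i) "ROOM AT THE
BOTTOM", lane INBOX 2026-08-20T23:25Z (2)), in the generality the walk calculus gives for free.  Pure real algebra on the cdf recursion `CB[a, p, m]`
of `…QuantBlobWalk.lean` plus ONE probabilistic input, p1 g7's two-threshold transport row `Quant.IndepBlob.prodBernoulli_gapRow_of_half_le_gate`
(`…QuantIndepBlobGapRow.lean`) read through the canonical model `BlobWalk.CB_eq_prodBernoulli`.  No definitions (`local notation3` only), no sorries,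
standard axioms.

**The mechanism (N22 (3′)).**  FAR at layer `j` for a block-comb is the exchange inequality `x·CB[K](j − c) ≤ Σ_{k<K} (w k − x) p k window_k(j)`
(`Quant.blockComb_exchange_identity`).  Its right side is `≥ (w_min − x)·Σ_k p k window_k(j) = (w_min − x)·P(S_K ≥ j+1)` (`CB_cross`); so FAR follows
from the TAIL ROW `P(S_K ≤ j − c) ≤ θ·P(S_K ≥ j+1)` with `θ = (1 − p₀)/p₀ ≤ (w_min − x)/x`.  Conditionally on the mass of the other blobs the tail row is
a statement about the group alone, and for a group with gates `≥ p₀ ≥ 1/2` and total mass `B ≥ 2j + 2 − c` every fibre is p1's gap row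
(`λ = j − c − s + 1 ≤ η = j + 1 − s`, `λ + η ≤ B`).  Nothing here uses the budget `EN > 2j`: in this regime FAR is STRUCTURAL (lead g11).

* `Quant.BlobWalk.CB_congr₂` — `CB[a,p,m]` depends only on the first `m` sizes and gates.
* `Quant.BlobWalk.tail_row_lift` — a two-threshold row `CB[n](t₁ − s) ≤ θ(1 − CB[n](t₂ − s))` valid for the TAIL walk at every shift `s ≥ 0` lifts to the
  whole walk (`BlobWalk.CB_head`: each head blob is a convex combination of two shifts).
* `Quant.BlobWalk.tail_gapRow` — the gap row in `CB` form: gates `u k ≥ p₀ ≥ 1/2` (`k < n`), `2j + 2 ≤ c + Σ_{k<n} b k` ⟹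
  `CB[b,u,n](j − c − s) ≤ (1−p₀)/p₀ · (1 − CB[b,u,n](j − s))` for every `s ≥ 0`.
* `Quant.BlobWalk.exchange_of_bottomRoom` — **the exchange inequality, hence FAR at layer `j`, for every block-comb (`x ≤ w k · p k`) containing a
  suffix group of blobs `m ≤ k < K` with `p k ≥ 1/2`, `x ≤ w_min · p k` (`w_min ≤` every chain weight; automatic for blobs at the bottom vertex) and
  `Σ_{m≤k<K} a k ≥ 2j + 2 − c` — NO budget hypothesis.**  Tree side: `Quant.farTree_blockComb_of_bottomRoom` (`…QuantFarTreeBlockCombBottomRoom.lean`).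
Exact re-check: `run/shared/lean/prim/quant/prim-quant-stmt-g14/code/check_bottom_room.py` (3 000 random rational block-combs with such a group, sizes up
to `j + 2`, arbitrary earlier gates: 0 violations of the exchange inequality, of the intermediate bound, and of the tail row).  [this work]
-/

noncomputable section

namespace Summit.CriticalPhenomena.PercolationContinuityZ3.Theorems

namespace Quant

namespace BlobWalk

open Finset MeasureTheory
open Literature.Probability.LatticeModels
open Literature.Probability.Percolation
open scoped Classical

/-- `CB[a, p, m] t` = probability that the open mass of the first `m` blobs (sizes `a`, gates `p`) is `≤ t` (the recursion of
`…QuantBlobWalk.lean`, verbatim). -/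
local notation3 "CB[" a ", " p ", " m "]" =>
  (Nat.rec (motive := fun _ => ℤ → ℝ) (fun t => if (0 : ℤ) ≤ t then (1 : ℝ) else 0)
    (fun n f t => (p : ℕ → ℝ) n * f (t - ((a : ℕ → ℕ) n : ℤ)) + (1 - (p : ℕ → ℝ) n) * f t) (m : ℕ))

/-- The open mass of the coordinates below `m` in the canonical model on `Fin M` (verbatim from `…QuantBlobWalkModel.lean`). -/
local notation3 "MASS[" a ", " M ", " m "]" =>
  (fun ω : Set (Fin (M : ℕ)) => ∑ i ∈ (Finset.univ : Finset (Fin M)).filter (fun i => i.val < (m : ℕ) ∧ i ∈ ω), (((a : ℕ → ℕ) i.val : ℕ) : ℤ))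

/-- `CB[a, p, m]` depends only on the sizes and gates of the first `m` blobs. [folklore] -/
theorem CB_congr₂ (a a' : ℕ → ℕ) (p p' : ℕ → ℝ) : ∀ m : ℕ, (∀ k, k < m → a k = a' k) → (∀ k, k < m → p k = p' k) →
    ∀ t : ℤ, CB[a, p, m] t = CB[a', p', m] t := by
  intro m
  induction m with
  | zero => intro _ _ t; rfl
  | succ m ih =>
    intro ha hp t
    have ih' := ih (fun k hk => ha k (by omega)) (fun k hk => hp k (by omega))
    rw [CB_succ a p m t, CB_succ a' p' m t, ih', ih', ha m (by omega), hp m (by omega)]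

/-! ### Lifting a tail row through the head blobs -/

/-- **Tail row lift.**  Let `(b, u)` be the tail of `(a, p)` after `m` blobs (`b i = a (m+i)`, `u i = p (m+i)` for `i < n`), gates in `[0,1]`.
If the tail walk satisfies `CB[b,u,n](t₁ − s) ≤ θ·(1 − CB[b,u,n](t₂ − s))` for every shift `s ≥ 0`, then the whole walk satisfies
`CB[a,p,m+n](t₁ − d) ≤ θ·(1 − CB[a,p,m+n](t₂ − d))` for every `d ≥ 0` (peel the head blobs with `BlobWalk.CB_head`: each is a convex combination of the
shifts `d` and `d + a 0`). [this work] -/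
theorem tail_row_lift (b : ℕ → ℕ) (u : ℕ → ℝ) (n : ℕ) (θ : ℝ) (t₁ t₂ : ℤ)
    (htail : ∀ s : ℤ, 0 ≤ s → CB[b, u, n] (t₁ - s) ≤ θ * (1 - CB[b, u, n] (t₂ - s))) :
    ∀ (m : ℕ) (a : ℕ → ℕ) (p : ℕ → ℝ), (∀ k, 0 ≤ p k ∧ p k ≤ 1) →
      (∀ i, i < n → b i = a (m + i)) → (∀ i, i < n → u i = p (m + i)) →
      ∀ d : ℤ, 0 ≤ d → CB[a, p, m + n] (t₁ - d) ≤ θ * (1 - CB[a, p, m + n] (t₂ - d)) := by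
  intro m
  induction m with
  | zero =>
    intro a p _ hb hu d hd
    have e : ∀ t : ℤ, CB[a, p, 0 + n] t = CB[b, u, n] t := fun t => by
      rw [Nat.zero_add]
      exact (CB_congr₂ b a u p n (fun i hi => by rw [hb i hi, Nat.zero_add]) (fun i hi => by rw [hu i hi, Nat.zero_add]) t).symm
    rw [e, e]
    exact htail d hd
  | succ m ih =>
    intro a p hp hb hu d hd
    rw [show m + 1 + n = (m + n) + 1 from by omega, CB_head a p (m + n) (t₁ - d), CB_head a p (m + n) (t₂ - d)]
    have hp' : ∀ k, 0 ≤ (fun i => p (i + 1)) k ∧ (fun i => p (i + 1)) k ≤ 1 := fun k => hp (k + 1)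
    have hb' : ∀ i, i < n → b i = (fun i => a (i + 1)) (m + i) := fun i hi => by
      rw [hb i hi, show m + 1 + i = m + i + 1 from by omega]
    have hu' : ∀ i, i < n → u i = (fun i => p (i + 1)) (m + i) := fun i hi => by
      rw [hu i hi, show m + 1 + i = m + i + 1 from by omega]
    have h1 := ih (fun i => a (i + 1)) (fun i => p (i + 1)) hp' hb' hu' (d + (a 0 : ℤ))
      (by have := Int.natCast_nonneg (a 0); omega)
    have h2 := ih (fun i => a (i + 1)) (fun i => p (i + 1)) hp' hb' hu' d hd
    have e1 : t₁ - d - (a 0 : ℤ) = t₁ - (d + (a 0 : ℤ)) := by ring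
    have e2 : t₂ - d - (a 0 : ℤ) = t₂ - (d + (a 0 : ℤ)) := by ring
    rw [e1, e2]
    have hp0 := hp 0
    have h1' := mul_le_mul_of_nonneg_left h1 hp0.1
    have h2' := mul_le_mul_of_nonneg_left h2 (sub_nonneg.2 hp0.2)
    nlinarith [h1', h2']

/-! ### The gap row in `CB` form -/

/-- **The two-threshold row for a walk with gates `≥ p₀ ≥ 1/2` and mass `≥ 2j + 2 − c`** (p1 g7's `IndepBlob.prodBernoulli_gapRow_of_half_le_gate`
read through the canonical model `CB_eq_prodBernoulli`): for every shift `s ≥ 0`,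
`CB[b,u,n](j − c − s) ≤ (1 − p₀)/p₀ · (1 − CB[b,u,n](j − s))` — thresholds `λ = j − c − s + 1 ≤ η = j + 1 − s`, `λ + η ≤ Σ b`. [this work] -/
theorem tail_gapRow (b : ℕ → ℕ) (u : ℕ → ℝ) (hu : ∀ k, 0 ≤ u k ∧ u k ≤ 1) (n : ℕ) (p₀ : ℝ)
    (hhalf : 1 / 2 ≤ p₀) (hp₀1 : p₀ ≤ 1) (hp₀ : ∀ k, k < n → p₀ ≤ u k) (j c : ℕ)
    (hB : 2 * j + 2 ≤ c + ∑ k ∈ Finset.range n, b k) (s : ℤ) (hs : 0 ≤ s) :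
    CB[b, u, n] ((j : ℤ) - (c : ℤ) - s) ≤ (1 - p₀) / p₀ * (1 - CB[b, u, n] ((j : ℤ) - s)) := by
  have hp₀pos : 0 < p₀ := by linarith
  have hθ0 : 0 ≤ (1 - p₀) / p₀ := div_nonneg (by linarith) hp₀pos.le
  rcases Nat.eq_zero_or_pos n with hn | hn
  · -- no blobs in the group: `c ≥ 2j + 2 > j`, the left side vanishes
    subst hn
    rw [Finset.sum_range_zero, add_zero] at hB
    have hneg : (j : ℤ) - (c : ℤ) - s < 0 := by omega
    rw [CB_of_neg b u 0 _ hneg]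
    exact mul_nonneg hθ0 (sub_nonneg.2 (CB_le_one b u hu 0 _))
  · -- canonical model on `Fin n`
    obtain ⟨k₀, hk₀, hmin⟩ := Finset.exists_min_image (Finset.range n) u ⟨0, Finset.mem_range.2 hn⟩
    have hk₀n : k₀ < n := Finset.mem_range.1 hk₀
    set pp : Fin n → unitInterval := fun i => ⟨u i.val, (hu i.val).1, (hu i.val).2⟩ with hpp
    have hmodel := CB_eq_prodBernoulli b u hu n n le_rfl
    have hppdef : (fun i : Fin n => (⟨u i.val, (hu i.val).1, (hu i.val).2⟩ : unitInterval)) = pp := by funext i; rfl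
    rw [hppdef] at hmodel
    have hmeas : ∀ T : Set (Set (Fin n)), MeasurableSet T := fun T => (Set.toFinite T).measurableSet
    -- the gap row in the canonical model, minimal gate `u k₀ ≥ p₀ ≥ 1/2`
    have hy : ∀ k : Fin n, pp ⟨k₀, hk₀n⟩ ≤ pp k := fun k => by
      change u k₀ ≤ u k.val
      exact hmin k.val (Finset.mem_range.2 k.isLt)
    have hhalf' : (1 : ℝ) / 2 ≤ ((pp ⟨k₀, hk₀n⟩ : unitInterval) : ℝ) := by
      change (1 : ℝ) / 2 ≤ u k₀; exact hhalf.trans (hp₀ k₀ hk₀n)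
    have hsumb : ∑ i : Fin n, ((b i.val : ℕ) : ℝ) = ((∑ k ∈ Finset.range n, b k : ℕ) : ℝ) := by
      rw [Nat.cast_sum]; exact Fin.sum_univ_eq_sum_range (fun k => (b k : ℝ)) n
    have hle : ((j : ℝ) - c - s + 1) + ((j : ℝ) + 1 - s) ≤ ∑ i : Fin n, ((b i.val : ℕ) : ℝ) := by
      rw [hsumb]
      have h1 : ((2 * j + 2 : ℕ) : ℝ) ≤ ((c + ∑ k ∈ Finset.range n, b k : ℕ) : ℝ) := by exact_mod_cast hB
      have h2 : (0 : ℝ) ≤ (s : ℝ) := by exact_mod_cast hs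
      push_cast at h1 ⊢
      linarith
    have hrow := IndepBlob.prodBernoulli_gapRow_of_half_le_gate pp (fun i : Fin n => ((b i.val : ℕ) : ℝ))
      (fun i => Nat.cast_nonneg _) ⟨k₀, hk₀n⟩ hy hhalf' ((j : ℝ) - c - s + 1) ((j : ℝ) + 1 - s)
      (by linarith [Nat.cast_nonneg (α := ℝ) c]) hle
    -- the two events of the row are cdf events of the canonical model
    have hfilt : ∀ ω : Set (Fin n), (Finset.univ : Finset (Fin n)).filter (fun i => i.val < n ∧ i ∈ ω) =
        (Finset.univ : Finset (Fin n)).filter (fun i => i ∈ ω) := by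
      intro ω; ext i
      simp only [Finset.mem_filter, Finset.mem_univ, true_and]
      exact ⟨fun h => h.2, fun h => ⟨i.isLt, h⟩⟩
    have hcast : ∀ ω : Set (Fin n), (∑ k ∈ (Finset.univ : Finset (Fin n)).filter (fun k => k ∈ ω), ((b k.val : ℕ) : ℝ)) =
        ((∑ i ∈ (Finset.univ : Finset (Fin n)).filter (fun i => i.val < n ∧ i ∈ ω), ((b i.val : ℕ) : ℤ) : ℤ) : ℝ) := by
      intro ω
      rw [hfilt ω, Int.cast_sum]
      exact Finset.sum_congr rfl fun i _ => by push_cast; rfl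
    have hE1 : {ω : Set (Fin n) | ∑ k ∈ (Finset.univ : Finset (Fin n)).filter (fun k => k ∈ ω), ((b k.val : ℕ) : ℝ) <
        (j : ℝ) - c - s + 1} = {ω : Set (Fin n) | MASS[b, n, n] ω ≤ (j : ℤ) - (c : ℤ) - s} := by
      ext ω
      simp only [Set.mem_setOf_eq]
      rw [hcast ω]
      set M : ℤ := ∑ i ∈ (Finset.univ : Finset (Fin n)).filter (fun i => i.val < n ∧ i ∈ ω), ((b i.val : ℕ) : ℤ) with hM
      constructor
      · intro h
        have h' : (M : ℝ) < (((j : ℤ) - (c : ℤ) - s + 1 : ℤ) : ℝ) := by push_cast; linarith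
        have := Int.cast_lt.1 h'
        omega
      · intro h
        have h' : (M : ℝ) ≤ (((j : ℤ) - (c : ℤ) - s : ℤ) : ℝ) := Int.cast_le.2 h
        push_cast at h'
        linarith
    have hE2 : {ω : Set (Fin n) | (j : ℝ) + 1 - s ≤
        ∑ k ∈ (Finset.univ : Finset (Fin n)).filter (fun k => k ∈ ω), ((b k.val : ℕ) : ℝ)} =
        {ω : Set (Fin n) | MASS[b, n, n] ω ≤ (j : ℤ) - s}ᶜ := by
      ext ω
      simp only [Set.mem_setOf_eq, Set.mem_compl_iff, not_le]
      rw [hcast ω]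
      set M : ℤ := ∑ i ∈ (Finset.univ : Finset (Fin n)).filter (fun i => i.val < n ∧ i ∈ ω), ((b i.val : ℕ) : ℤ) with hM
      constructor
      · intro h
        have h' : (((j : ℤ) - s + 1 : ℤ) : ℝ) ≤ (M : ℝ) := by push_cast; linarith
        have := Int.cast_le.1 h'
        omega
      · intro h
        have h1 : (j : ℤ) - s + 1 ≤ M := by omega
        have h' : (((j : ℤ) - s + 1 : ℤ) : ℝ) ≤ (M : ℝ) := Int.cast_le.2 h1
        push_cast at h'
        linarith
    rw [hE1, hE2, probReal_compl_eq_one_sub (hmeas _), ← hmodel ((j : ℤ) - (c : ℤ) - s), ← hmodel ((j : ℤ) - s)] at hrow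
    -- `hrow : u k₀ · CB(j−c−s) ≤ (1 − u k₀) · (1 − CB(j−s))`
    have hu₀ : p₀ ≤ u k₀ := hp₀ k₀ hk₀n
    have hupos : 0 < u k₀ := hp₀pos.trans_le hu₀
    have hpp0 : ((pp ⟨k₀, hk₀n⟩ : unitInterval) : ℝ) = u k₀ := rfl
    rw [hpp0] at hrow
    have h1m : 0 ≤ 1 - CB[b, u, n] ((j : ℤ) - s) := sub_nonneg.2 (CB_le_one b u hu n _)
    have key : CB[b, u, n] ((j : ℤ) - (c : ℤ) - s) ≤ (1 - u k₀) / u k₀ * (1 - CB[b, u, n] ((j : ℤ) - s)) := by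
      rw [div_mul_eq_mul_div, le_div_iff₀ hupos]
      linarith
    have hθmono : (1 - u k₀) / u k₀ ≤ (1 - p₀) / p₀ := by
      rw [div_le_div_iff₀ hupos hp₀pos]
      nlinarith
    exact key.trans (mul_le_mul_of_nonneg_right hθmono h1m)

/-! ### The exchange inequality with room at the bottom -/

/-- **FAR exchange inequality with ROOM AT THE BOTTOM (no budget hypothesis).**  Blobs `(a k, p k)_{k<K}` with gates in `[0,1]`, terminal block
`c`, layer `j`, chain weights `w` and least marginal `x ≥ 0` with `x ≤ w k · p k` (`k < K`), and a lower bound `w_min ≤ w k` of the chain weights.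
If a suffix group of blobs `m ≤ k < K` has gates `p k ≥ 1/2` with `x ≤ w_min · p k` and carries `Σ_{m≤k<K} a k ≥ 2j + 2 − c` relays, then
`x · CB[K](j − c) ≤ Σ_{k<K} (w k − x) · p k · (CB[k] j − CB[k](j − a k))` — by `Quant.blockComb_exchange_identity` this is FAR at layer `j` for the
block-comb.  (RHS `≥ (w_min − x)(1 − CB[K] j)` by `CB_cross`; tail row from `tail_gapRow` + `tail_row_lift`; `x·(1−p₀)/p₀ ≤ w_min − x`.) [this work] -/
theorem exchange_of_bottomRoom (a : ℕ → ℕ) (p : ℕ → ℝ) (hp : ∀ k, 0 ≤ p k ∧ p k ≤ 1) (K m : ℕ) (hmK : m ≤ K) (j c : ℕ)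
    (x : ℝ) (w : ℕ → ℝ) (wmin : ℝ) (hx : 0 ≤ x) (hwx : ∀ k, k < K → x ≤ w k * p k) (hwmin : ∀ k, k < K → wmin ≤ w k)
    (hgrp : ∀ k, m ≤ k → k < K → 1 / 2 ≤ p k ∧ x ≤ wmin * p k)
    (hB : 2 * j + 2 ≤ c + ∑ k ∈ Finset.Ico m K, a k) :
    x * CB[a, p, K] ((j : ℤ) - (c : ℤ)) ≤
      ∑ k ∈ Finset.range K, (w k - x) * p k * (CB[a, p, k] (j : ℤ) - CB[a, p, k] ((j : ℤ) - (a k : ℤ))) := by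
  set W : ℕ → ℝ := fun k => CB[a, p, k] (j : ℤ) - CB[a, p, k] ((j : ℤ) - (a k : ℤ)) with hWdef
  have hW0 : ∀ k, 0 ≤ W k := fun k => window_nonneg a p hp k _
  have hcross : ∑ k ∈ Finset.range K, p k * W k = 1 - CB[a, p, K] (j : ℤ) := by
    have := CB_cross a p K (j : ℤ)
    rw [CB_zero_of_nonneg a p (Int.natCast_nonneg j)] at this
    rw [this]
  -- termwise: `(w k − x) p k W k ≥ x (1 − p k) W k ≥ 0` and `≥ (wmin − x) p k W k`
  have hterm0 : ∀ k ∈ Finset.range K, 0 ≤ (w k - x) * p k * W k := by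
    intro k hk
    have hkK := Finset.mem_range.1 hk
    have : 0 ≤ (w k - x) * p k := by nlinarith [hwx k hkK, (hp k).2]
    exact mul_nonneg this (hW0 k)
  have hRHS0 : 0 ≤ ∑ k ∈ Finset.range K, (w k - x) * p k * W k := Finset.sum_nonneg hterm0
  have hRHS : (wmin - x) * (1 - CB[a, p, K] (j : ℤ)) ≤ ∑ k ∈ Finset.range K, (w k - x) * p k * W k := by
    rw [← hcross, Finset.mul_sum]
    refine Finset.sum_le_sum fun k hk => ?_
    have hkK := Finset.mem_range.1 hk
    have hpw : 0 ≤ p k * W k := mul_nonneg (hp k).1 (hW0 k)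
    calc (wmin - x) * (p k * W k) ≤ (w k - x) * (p k * W k) :=
          mul_le_mul_of_nonneg_right (by linarith [hwmin k hkK]) hpw
      _ = (w k - x) * p k * W k := by ring
  by_cases hmK' : m = K
  · -- empty group: `c ≥ 2j + 2`, the light cdf vanishes
    subst hmK'
    rw [Finset.Ico_self, Finset.sum_empty, add_zero] at hB
    have hneg : (j : ℤ) - (c : ℤ) < 0 := by omega
    rw [CB_of_neg a p m _ hneg, mul_zero]
    exact hRHS0
  · have hmK2 : m < K := lt_of_le_of_ne hmK hmK'
    -- the minimal gate of the group
    obtain ⟨k₁, hk₁, hmin⟩ := Finset.exists_min_image (Finset.Ico m K) p ⟨m, Finset.mem_Ico.2 ⟨le_rfl, hmK2⟩⟩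
    rw [Finset.mem_Ico] at hk₁
    set p₀ : ℝ := p k₁ with hp₀def
    have hhalf : 1 / 2 ≤ p₀ := (hgrp k₁ hk₁.1 hk₁.2).1
    have hxp₀ : x ≤ wmin * p₀ := (hgrp k₁ hk₁.1 hk₁.2).2
    have hp₀1 : p₀ ≤ 1 := (hp k₁).2
    have hp₀pos : 0 < p₀ := by linarith
    -- the tail walk `(b, u)` = blobs `m ≤ k < K`
    set n : ℕ := K - m with hn
    set b : ℕ → ℕ := fun i => a (m + i) with hb
    set u : ℕ → ℝ := fun i => p (m + i) with hu
    have hu01 : ∀ k, 0 ≤ u k ∧ u k ≤ 1 := fun k => hp (m + k)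
    have hp₀u : ∀ i, i < n → p₀ ≤ u i := fun i hi => hmin (m + i) (Finset.mem_Ico.2 ⟨by omega, by omega⟩)
    have hBn : 2 * j + 2 ≤ c + ∑ k ∈ Finset.range n, b k := by
      have : ∑ k ∈ Finset.Ico m K, a k = ∑ k ∈ Finset.range n, b k := by
        rw [Finset.sum_Ico_eq_sum_range]
      rwa [this] at hB
    have htail : ∀ s : ℤ, 0 ≤ s → CB[b, u, n] ((j : ℤ) - (c : ℤ) - s) ≤ (1 - p₀) / p₀ * (1 - CB[b, u, n] ((j : ℤ) - s)) :=
      fun s hs => tail_gapRow b u hu01 n p₀ hhalf hp₀1 hp₀u j c hBn s hs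
    have hlift := tail_row_lift b u n ((1 - p₀) / p₀) ((j : ℤ) - (c : ℤ)) (j : ℤ) htail m a p hp
      (fun i _ => rfl) (fun i _ => rfl) 0 le_rfl
    rw [sub_zero, sub_zero, show m + n = K from by omega] at hlift
    -- `x · CB[K](j − c) ≤ x·θ₀·(1 − CB[K] j) ≤ (wmin − x)(1 − CB[K] j) ≤ RHS`
    have h1m : 0 ≤ 1 - CB[a, p, K] (j : ℤ) := sub_nonneg.2 (CB_le_one a p hp K _)
    have hxθ : x * ((1 - p₀) / p₀) ≤ wmin - x := by
      rw [mul_div_assoc', div_le_iff₀ hp₀pos]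
      nlinarith
    calc x * CB[a, p, K] ((j : ℤ) - (c : ℤ)) ≤ x * ((1 - p₀) / p₀ * (1 - CB[a, p, K] (j : ℤ))) :=
          mul_le_mul_of_nonneg_left hlift hx
      _ = x * ((1 - p₀) / p₀) * (1 - CB[a, p, K] (j : ℤ)) := by ring
      _ ≤ (wmin - x) * (1 - CB[a, p, K] (j : ℤ)) := mul_le_mul_of_nonneg_right hxθ h1m
      _ ≤ ∑ k ∈ Finset.range K, (w k - x) * p k * W k := hRHS

end BlobWalk

end Quant

end Summit.CriticalPhenomena.PercolationContinuityZ3.Theorems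

end
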